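import Mathlib
import HarnessLib

/-!
# Crux `PriceOfContractivity` (stmt-ValiantsHypothesis-10583), line `birth` — stub `stub_arcInduction`

Lemma 2 ("arc bound") of the cycle-mean estimate (Theorem 4, max cycle geometric mean
`≤ 240 R³ ×` principal-minor radius): on an `n × n` block `B` with unit superdiagonal, entries of
norm `≤ 1` and interval principal minors `‖det B[a..a+k]‖ ≤ δ^(k+1)` (`δ ≤ 1/(240 n³)`), every
backward entry satisfies `‖B (a+k) a‖ ≤ (16 n)^k δ^(k+1)`.

This file is the glue: strong induction on the arc length `k`.  For `k = 0` the `1 × 1` interval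
minor is the entry itself.  For `k ≥ 1` the one-step estimate (hypothesis 1, the statement of the
sibling stub `stub_arcStep`) is applied to the interval block `B[a..a+k]` reindexed to `Fin (k+1)`
with the weights `y_l = (16 n)^l δ^(l+1)`: its unit superdiagonal, forward bound and determinant
bound are those of `B`, its backward entries of length `< k` are bounded by the induction
hypothesis, `δ^(k+1) ≤ y_k / 4` because `(16 n)^k ≥ 4`, and the two permutation sums are bounded
by hypothesis 2 (the statement of the sibling stub `stub_permCounts`).
-/

-- single-conjunct layout: Sub = Summit, duplicated namespace component intended
set_option linter.dupNamespace false

namespace Summit.ValiantsHypothesis.ValiantsHypothesis.Theorems.PriceOfContractivity.ArcInduction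

open Matrix

/-- **Arc induction (Lemma 2 of the cycle-mean bound) from the one-step estimate and the
permutation counts.** If (1) the one-step estimate holds — on an `(m+1) × (m+1)` matrix with unit
superdiagonal, forward entries of norm `≤ 1`, determinant of norm `≤ δ^(m+1)`, backward entries of
length `l < m` of norm `≤ y_l`, `δ^(m+1) ≤ y_m / 4` and the two permutation sums bounded by
`y_m / 4` and `3 / 2`, the corner entry has norm `≤ y_m` — and (2) the two permutation sums with
`y_l = (16 n)^l δ^(l+1)`, `δ ≤ 1 / (240 n³)`, are bounded by `y_m / 4` and `3 / 2`, then on an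
`n × n` matrix `B` (`n ≥ 2`) with unit superdiagonal, entries of norm `≤ 1` and interval principal
minors `‖det B[a..a+k]‖ ≤ δ^(k+1)`, every backward entry satisfies
`‖B (a+k) a‖ ≤ (16 n)^k δ^(k+1)`.  Proof: strong induction on `k`, applying (1) to the interval
block `B[a..a+k]` reindexed to `Fin (k+1)`. [folklore] -/
theorem stub_arcInduction :
    (∀ (m : ℕ) (A : Matrix (Fin (m + 1)) (Fin (m + 1)) ℂ) (y : ℕ → ℝ) (δ : ℝ),
      1 ≤ m → 0 ≤ δ → (∀ l, 0 ≤ y l) →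
      (∀ (t : ℕ) (h : t + 1 < m + 1), A ⟨t, by omega⟩ ⟨t + 1, h⟩ = 1) →
      (∀ i j : Fin (m + 1), i.val < j.val → ‖A i j‖ ≤ 1) →
      ‖A.det‖ ≤ δ ^ (m + 1) →
      (∀ i j : Fin (m + 1), j.val ≤ i.val → i.val - j.val < m → ‖A i j‖ ≤ y (i.val - j.val)) →
      δ ^ (m + 1) ≤ y m / 4 →
      (∑ σ ∈ (Finset.univ : Finset (Equiv.Perm (Fin (m + 1)))).filter (fun σ => σ 0 ≠ Fin.last m),
          ∏ i ∈ (Finset.univ : Finset (Fin (m + 1))).filter (fun i => i.val ≤ (σ i).val),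
            y ((σ i).val - i.val)) ≤ y m / 4 →
      (∑ σ ∈ (Finset.univ : Finset (Equiv.Perm (Fin (m + 1)))).filter (fun σ => σ 0 = Fin.last m),
          ∏ i ∈ (Finset.univ : Finset (Fin (m + 1))).filter (fun i => i ≠ 0 ∧ i.val ≤ (σ i).val),
            y ((σ i).val - i.val)) ≤ 3 / 2 →
      ‖A (Fin.last m) 0‖ ≤ y m) →
    (∀ (n m : ℕ) (δ : ℝ), 1 ≤ m → m + 1 ≤ n → 0 ≤ δ → δ ≤ 1 / (240 * (n : ℝ) ^ 3) →
      (∑ σ ∈ (Finset.univ : Finset (Equiv.Perm (Fin (m + 1)))).filter (fun σ => σ 0 ≠ Fin.last m),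
          ∏ i ∈ (Finset.univ : Finset (Fin (m + 1))).filter (fun i => i.val ≤ (σ i).val),
            (16 * (n : ℝ)) ^ ((σ i).val - i.val) * δ ^ ((σ i).val - i.val + 1)) ≤
          (16 * (n : ℝ)) ^ m * δ ^ (m + 1) / 4 ∧
      (∑ σ ∈ (Finset.univ : Finset (Equiv.Perm (Fin (m + 1)))).filter (fun σ => σ 0 = Fin.last m),
          ∏ i ∈ (Finset.univ : Finset (Fin (m + 1))).filter (fun i => i ≠ 0 ∧ i.val ≤ (σ i).val),
            (16 * (n : ℝ)) ^ ((σ i).val - i.val) * δ ^ ((σ i).val - i.val + 1)) ≤ 3 / 2) →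
    ∀ (n : ℕ) (B : Matrix (Fin n) (Fin n) ℂ) (δ : ℝ), 2 ≤ n → 0 ≤ δ → δ ≤ 1 / (240 * (n : ℝ) ^ 3) →
      (∀ (t : ℕ) (h : t + 1 < n), B ⟨t, by omega⟩ ⟨t + 1, h⟩ = 1) →
      (∀ i j : Fin n, ‖B i j‖ ≤ 1) →
      (∀ (a k : ℕ) (h : a + k < n),
        ‖(B.submatrix (fun i : Fin (k + 1) => (⟨a + i.val, by omega⟩ : Fin n))
          (fun i : Fin (k + 1) => (⟨a + i.val, by omega⟩ : Fin n))).det‖ ≤ δ ^ (k + 1)) →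
      ∀ (a k : ℕ) (h : a + k < n), ‖B ⟨a + k, h⟩ ⟨a, by omega⟩‖ ≤ (16 * (n : ℝ)) ^ k * δ ^ (k + 1) := by
  intro hstep hcount n B δ hn hδ0 hδ hsup hfwd hminor a k
  induction k using Nat.strong_induction_on generalizing a with
  | _ k ih =>
  intro h
  rcases Nat.eq_zero_or_pos k with rfl | hk
  · -- `k = 0`: the `1 × 1` interval minor at `a` is the entry `B a a` itself.
    have h1 := hminor a 0 h
    rw [Matrix.det_eq_elem_of_card_eq_one (by simp) 0] at h1
    simpa [Matrix.submatrix_apply] using h1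
  · -- `k ≥ 1`: apply the step to the interval block `B[a..a+k]` reindexed to `Fin (k+1)`.
    have hy0 : ∀ l : ℕ, 0 ≤ (16 * (n : ℝ)) ^ l * δ ^ (l + 1) := fun l =>
      mul_nonneg (pow_nonneg (by positivity) l) (pow_nonneg hδ0 (l + 1))
    -- the induction hypothesis, restated on natural-number indices
    have ih' : ∀ (i j : ℕ) (hi : i < n) (hj : j < n), j ≤ i → i - j < k →
        ‖B ⟨i, hi⟩ ⟨j, hj⟩‖ ≤ (16 * (n : ℝ)) ^ (i - j) * δ ^ (i - j + 1) := by
      intro i j hi hj hji hlt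
      obtain ⟨l, rfl⟩ : ∃ l, i = j + l := ⟨i - j, by omega⟩
      rw [Nat.add_sub_cancel_left]
      exact ih l (by omega) j hi
    -- `δ^(k+1) ≤ y_k / 4` since `(16 n)^k ≥ 16 n ≥ 4`
    have hΛ : (4 : ℝ) ≤ (16 * (n : ℝ)) ^ k := by
      have hn' : (2 : ℝ) ≤ n := by exact_mod_cast hn
      calc (4 : ℝ) ≤ 16 * n := by linarith
        _ ≤ (16 * (n : ℝ)) ^ k := le_self_pow₀ (by linarith) (by omega)
    have hsmall : δ ^ (k + 1) ≤ (16 * (n : ℝ)) ^ k * δ ^ (k + 1) / 4 := by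
      rw [le_div_iff₀ (by norm_num : (0 : ℝ) < 4)]
      calc δ ^ (k + 1) * 4 = 4 * δ ^ (k + 1) := by ring
        _ ≤ (16 * (n : ℝ)) ^ k * δ ^ (k + 1) :=
          mul_le_mul_of_nonneg_right hΛ (pow_nonneg hδ0 _)
    have hfin := hstep k
      (B.submatrix (fun i : Fin (k + 1) => (⟨a + i.val, by omega⟩ : Fin n))
        (fun i : Fin (k + 1) => (⟨a + i.val, by omega⟩ : Fin n)))
      (fun l => (16 * (n : ℝ)) ^ l * δ ^ (l + 1)) δ hk hδ0 hy0
      (fun t ht => by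
        simp only [Matrix.submatrix_apply]
        exact hsup (a + t) (by omega))
      (fun i j _ => by
        simp only [Matrix.submatrix_apply]
        exact hfwd _ _)
      (hminor a k h)
      (fun i j hji hlt => by
        simp only [Matrix.submatrix_apply]
        have e : a + i.val - (a + j.val) = i.val - j.val := by omega
        have := ih' (a + i.val) (a + j.val) (by omega) (by omega) (by omega) (by omega)
        rw [e] at this
        exact this)
      hsmall (hcount n k δ hk (by omega) hδ0 hδ).1 (hcount n k δ hk (by omega) hδ0 hδ).2
    simpa [Matrix.submatrix_apply] using hfin

end Summit.ValiantsHypothesis.ValiantsHypothesis.Theorems.PriceOfContractivity.ArcInduction
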